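import Summits.AtomisticToContinuum.Crystallization.Theorems.FrustratedLawDichotomyCellTEQ15Data

/-!
# FrustratedLawDichotomy · crux `AperiodicFrustratedLawGap` (stmt-AtomisticToContinuum-27623) — TEQ15 witness cell: class 0 sums A
# (decomp-a2c, prover hand 2, generation 17; each theorem ONE `decide +kernel`, split for the farm's per-declaration budget). [folklore]
-/

namespace Summit.AtomisticToContinuum.Crystallization.Theorems.FrustratedLawDichotomyCellTEQ15

open scoped BigOperators
open Summit.AtomisticToContinuum.Crystallization.Theorems.FrustratedLawDichotomyCellChecker
open Summit.AtomisticToContinuum.Crystallization.Theorems.FrustratedLawDichotomyCellKitX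

set_option maxHeartbeats 0 in
/-- Kernel value of the `S` sum of class `0`. [folklore] -/
theorem teq15_sum0_S : sumX cellTEQ15 (termS cellTEQ15 cellTEQ15P ⟨0, by decide⟩) = ((-1053096618753 : ℚ) / 1099511627776) := by decide +kernel

set_option maxHeartbeats 0 in
/-- Kernel value of the `F0` sum of class `0`. [folklore] -/
theorem teq15_sum0_F0 : sumX cellTEQ15 (termF cellTEQ15 cellTEQ15P 0 ⟨0, by decide⟩) = ((117973170681 : ℚ) / 1099511627776) := by decide +kernel

set_option maxHeartbeats 0 in
/-- Kernel value of the `F1` sum of class `0`. [folklore] -/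
theorem teq15_sum0_F1 : sumX cellTEQ15 (termF cellTEQ15 cellTEQ15P 1 ⟨0, by decide⟩) = ((-13003236197 : ℚ) / 1099511627776) := by decide +kernel

set_option maxHeartbeats 0 in
/-- Kernel value of the `F2` sum of class `0`. [folklore] -/
theorem teq15_sum0_F2 : sumX cellTEQ15 (termF cellTEQ15 cellTEQ15P 2 ⟨0, by decide⟩) = ((-51276405 : ℚ) / 8589934592) := by decide +kernel

end Summit.AtomisticToContinuum.Crystallization.Theorems.FrustratedLawDichotomyCellTEQ15
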